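import Literature.AnabelianGeometry.SemiGraphs.TemperedEdgeImagesOfPersistent
import Literature.AnabelianGeometry.SemiGraphs.TemperedFixedSystemOfFiniteImages
import Literature.AnabelianGeometry.SemiGraphs.TemperedFixedSystemsOfEdgeImages
import Literature.AnabelianGeometry.SemiGraphs.TemperedCompactInVerticialAtOfNoEscape
import HarnessLib

/-!
# [SemiAnbd] Thm 3.7 (iii) AT a locally finite countable `𝒢`: persistence of a base vertex suffices

Mochizuki, *Semi-graphs of anabelioids*, Publ. RIMS **42** (2006), §3, Theorem 3.7 (iii) pp. 40–41 ("we may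
assume that there exists a compatible system of vertices of `𝒢_{∞,j}` … fixed by `H`"; "these two vertices
are joined to one another by a single [closed] edge") and Corollary 3.9 p. 42
[cite: MochizukiSemiAnbd2006, Thm 3.7(iii) pp.40-41].

PROOF-ONLY (cell abc-iut, layer L3, row T37iii·LOCFIN-PERSIST (B3), L3-lead ruling α91; seat
abc-iut-w6-d066; no definition, no new named fact).  From `pointOrEdge_images_of_persistent`
(`TemperedEdgeImagesOfPersistent.lean`):

* abstract level data (`VerticialLevelData` with levels / immersions / finite fibres / (I4′)_cpt):
  `hfix_of_persistent_locFin`, `hbdd_of_persistent_locFin` — at a LOCALLY FINITE `𝔾` a compact `C ≠ 1`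
  with a persistent base vertex fixes a compatible vertex system, and compatible `C`-fixed systems stay at
  subdivision distance `≤ 4` (the two binders of abc-iut-L3-t10's closer `compactInVerticialAt_of_noEscape`);
* canonical tower of the constructed chart (levels = orbit graphs `𝔾_{S n}` of the Galois tower, `treeQuot`
  immersions, `levelAct`, `levelTrans`, `orbitGraphProj`; finite fibres since the covers `S n` are finite —
  `CovObj.finite_oVertex_over`, `CovObj.finite_orbitGraph_branch_over`, for an ARBITRARY `𝒢`; (I4′)_cpt =
  abc-iut-L3-t8's `stabBranchPairCpt'_temperedPiChart` with (I0v) `galoisLevelData_faithfulV`):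
  `hfix_temperedPiChart_of_persistent_locFin`, `hbdd_temperedPiChart_of_persistent_locFin`;
* **`compactInVerticialAt_of_locallyFinite_of_persistent`** — Theorem 3.7 (iii) AT a locally finite `𝒢`
  from the single combinatorial input «every nontrivial compact subgroup has a persistent base vertex»;
  **`compactInVerticialAt_or_horizontalEscape`** — the dichotomy: (iii) holds AT `𝒢`, or some nontrivial
  compact subgroup escapes horizontally (as at the cell's countermodel `𝒢_θ`).  So at locally finite graphs
  the «vertical / torsor» regime of the memo SHAPES-Ggt6g32 §(f) cannot occur.

The adjacency clause `hadj` (distinct compatible fixed systems are the ends of one `C`-fixed edge) is the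
companion file `TemperedFixedSystemsOfPersistentLocFin.lean`.  Nothing here bears on [IUTchIII] Cor. 3.12.
-/

namespace Literature.AnabelianGeometry.SemiGraphs

namespace ProfiniteSemiGraph

namespace VerticialLevelData

open CategoryTheory Topology

universe v u

variable {𝒢 : ProfiniteSemiGraph.{u}} {c : TemperedPiChart 𝒢} (D : VerticialLevelData.{v} 𝒢 c)

section Levels

/-! ### The level structure (abstract): levels, immersions, actions, transitions, projections -/

variable (level : D.J → SemiGraph.{u}) (quot : ∀ j, D.tree j ⟶ level j)
  (levelAct : ∀ j, c.G →* Aut (level j))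
  (levelTrans : ∀ ⦃i j : D.J⦄, i ≤ j → (level j ⟶ level i))
  (levelProj : ∀ j, level j ⟶ 𝒢.graph)

/-- The common hypothesis package of the three (FIX∞) corollaries below, spelled out each time (no
definition): level structure with immersions, equivariance and transition squares, finite level fibres
over `𝔾`, local finiteness of `𝔾`, (I4′)_cpt, a persistent base vertex: at every level two compatible `C`-fixed
systems coincide or are the two ends of one edge. [cite: MochizukiSemiAnbd2006, Thm 3.7(iii) p.41] -/
private theorem pointOrEdge_aux (h𝒢 : 𝒢.Thm37Hypotheses) (C : Subgroup c.G) (hC1 : C ≠ ⊥)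
    (quot_isImmersion : ∀ j, SemiGraph.IsImmersion (quot j))
    (act_quot : ∀ (j : D.J) (g : c.G), (D.act j g).hom ≫ quot j = quot j ≫ (levelAct j g).hom)
    (trans_quot : ∀ ⦃i j : D.J⦄ (h : i ≤ j), D.trans h ≫ quot i = quot j ≫ levelTrans h)
    (levelTrans_id : ∀ j, levelTrans (le_refl j) = 𝟙 (level j))
    (levelTrans_comp : ∀ ⦃i j k : D.J⦄ (hij : i ≤ j) (hjk : j ≤ k),
      levelTrans hjk ≫ levelTrans hij = levelTrans (hij.trans hjk))
    (quot_proj : ∀ j, quot j ≫ levelProj j = D.proj j)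
    (levelTrans_proj : ∀ ⦃i j : D.J⦄ (h : i ≤ j), levelTrans h ≫ levelProj i = levelProj j)
    (finV : ∀ (j : D.J) (v : 𝒢.graph.Vertex), {w : (level j).Vertex | (levelProj j).vertexMap w = v}.Finite)
    (finB : ∀ (j : D.J) (b : 𝒢.graph.Branch), {β : (level j).Branch | (levelProj j).branchMap β = b}.Finite)
    (hlf : ∀ v : 𝒢.graph.Vertex, {b : 𝒢.graph.Branch | 𝒢.graph.abuts b = some v}.Finite)
    (stabC : ∀ (j₀ : D.J) (w : ∀ i : {i : D.J // j₀ ≤ i}, (level i.1).Vertex)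
      (β β' : ∀ i : {i : D.J // j₀ ≤ i}, (level i.1).Branch),
      (∀ i, β i ≠ β' i ∧ (level i.1).abuts (β i) = some (w i) ∧ (level i.1).abuts (β' i) = some (w i)) →
      (∀ ⦃i i' : {i : D.J // j₀ ≤ i}⦄ (h : i.1 ≤ i'.1), (levelTrans h).vertexMap (w i') = w i ∧
        (levelTrans h).branchMap (β i') = β i ∧ (levelTrans h).branchMap (β' i') = β' i) →
      ∃ (Q : Type u) (_ : Group Q) (ιQ : c.G →* Q) (v : 𝒢.graph.Vertex) (b b' : 𝒢.graph.Branch)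
        (hb : 𝒢.graph.abuts b = some v) (hb' : 𝒢.graph.abuts b' = some v) (ψ : 𝒢.Gv v →* Q) (x x' : 𝒢.Gv v),
        Set.InjOn ιQ C ∧ Function.Injective ψ ∧ (b' ≠ b ∨ x⁻¹ * x' ∉ 𝒢.branchSubgroup b v hb) ∧
        ∀ g ∈ C, (∀ i, (levelAct i.1 g).hom.vertexMap (w i) = w i ∧
          (levelAct i.1 g).hom.branchMap (β i) = β i ∧ (levelAct i.1 g).hom.branchMap (β' i) = β' i) →
          ιQ g ∈ ((𝒢.branchSubgroup b v hb).map (MulAut.conj x).toMonoidHom).map ψ ⊓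
            ((𝒢.branchSubgroup b' v hb').map (MulAut.conj x').toMonoidHom).map ψ)
    (v : 𝒢.graph.Vertex)
    (hpers : ∀ j, ∃ x : (D.tree j).Vertex, (D.proj j).vertexMap x = v ∧
      ∀ g ∈ C, (D.act j g).hom.vertexMap x = x)
    (x x' : ∀ j, (D.tree j).Vertex)
    (hx : ∀ ⦃i j : D.J⦄ (h : i ≤ j), (D.trans h).vertexMap (x j) = x i)
    (hx' : ∀ ⦃i j : D.J⦄ (h : i ≤ j), (D.trans h).vertexMap (x' j) = x' i)
    (hfx : ∀ g ∈ C, ∀ j, (D.act j g).hom.vertexMap (x j) = x j)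
    (hfx' : ∀ g ∈ C, ∀ j, (D.act j g).hom.vertexMap (x' j) = x' j) (j : D.J) :
    x j = x' j ∨ ∃ (e : (D.tree j).Edge) (b b' : (D.tree j).Branch),
      (D.tree j).edgeOf b = e ∧ (D.tree j).edgeOf b' = e ∧
      (D.tree j).abuts b = some (x j) ∧ (D.tree j).abuts b' = some (x' j) := by
  obtain ⟨k, h, hcase⟩ := D.pointOrEdge_images_of_persistent level quot levelAct levelTrans levelProj h𝒢 C
    hC1 quot_isImmersion act_quot trans_quot levelTrans_id levelTrans_comp quot_proj levelTrans_proj finV finB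
    hlf stabC v hpers j
  rcases hcase with ⟨y, hy⟩ | ⟨e, he⟩
  · left
    rw [← hx h, ← hx' h, hy (x k) (fun g hg => hfx g hg k), hy (x' k) (fun g hg => hfx' g hg k)]
  · right
    obtain ⟨b, hbe, hb⟩ := he (x k) (fun g hg => hfx g hg k)
    obtain ⟨b', hb'e, hb'⟩ := he (x' k) (fun g hg => hfx' g hg k)
    rw [hx h] at hb
    rw [hx' h] at hb'
    exact ⟨e, b, b', hbe, hb'e, hb, hb'⟩

/-- **`hfix` over a persistent vertex of a locally finite `𝔾`**: a compact `C ≠ 1` with a persistent base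
vertex fixes a compatible system of tree vertices (point- or edge-sized images are finite images:
`hfix_of_eventually_finite_images`). [cite: MochizukiSemiAnbd2006, Thm 3.7(iii) p.41] -/
theorem hfix_of_persistent_locFin (h𝒢 : 𝒢.Thm37Hypotheses) (C : Subgroup c.G)
    (hC : IsCompact (C : Set c.G)) (hC1 : C ≠ ⊥)
    (quot_isImmersion : ∀ j, SemiGraph.IsImmersion (quot j))
    (act_quot : ∀ (j : D.J) (g : c.G), (D.act j g).hom ≫ quot j = quot j ≫ (levelAct j g).hom)
    (trans_quot : ∀ ⦃i j : D.J⦄ (h : i ≤ j), D.trans h ≫ quot i = quot j ≫ levelTrans h)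
    (levelTrans_id : ∀ j, levelTrans (le_refl j) = 𝟙 (level j))
    (levelTrans_comp : ∀ ⦃i j k : D.J⦄ (hij : i ≤ j) (hjk : j ≤ k),
      levelTrans hjk ≫ levelTrans hij = levelTrans (hij.trans hjk))
    (quot_proj : ∀ j, quot j ≫ levelProj j = D.proj j)
    (levelTrans_proj : ∀ ⦃i j : D.J⦄ (h : i ≤ j), levelTrans h ≫ levelProj i = levelProj j)
    (finV : ∀ (j : D.J) (v : 𝒢.graph.Vertex), {w : (level j).Vertex | (levelProj j).vertexMap w = v}.Finite)
    (finB : ∀ (j : D.J) (b : 𝒢.graph.Branch), {β : (level j).Branch | (levelProj j).branchMap β = b}.Finite)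
    (hlf : ∀ v : 𝒢.graph.Vertex, {b : 𝒢.graph.Branch | 𝒢.graph.abuts b = some v}.Finite)
    (stabC : ∀ (j₀ : D.J) (w : ∀ i : {i : D.J // j₀ ≤ i}, (level i.1).Vertex)
      (β β' : ∀ i : {i : D.J // j₀ ≤ i}, (level i.1).Branch),
      (∀ i, β i ≠ β' i ∧ (level i.1).abuts (β i) = some (w i) ∧ (level i.1).abuts (β' i) = some (w i)) →
      (∀ ⦃i i' : {i : D.J // j₀ ≤ i}⦄ (h : i.1 ≤ i'.1), (levelTrans h).vertexMap (w i') = w i ∧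
        (levelTrans h).branchMap (β i') = β i ∧ (levelTrans h).branchMap (β' i') = β' i) →
      ∃ (Q : Type u) (_ : Group Q) (ιQ : c.G →* Q) (v : 𝒢.graph.Vertex) (b b' : 𝒢.graph.Branch)
        (hb : 𝒢.graph.abuts b = some v) (hb' : 𝒢.graph.abuts b' = some v) (ψ : 𝒢.Gv v →* Q) (x x' : 𝒢.Gv v),
        Set.InjOn ιQ C ∧ Function.Injective ψ ∧ (b' ≠ b ∨ x⁻¹ * x' ∉ 𝒢.branchSubgroup b v hb) ∧
        ∀ g ∈ C, (∀ i, (levelAct i.1 g).hom.vertexMap (w i) = w i ∧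
          (levelAct i.1 g).hom.branchMap (β i) = β i ∧ (levelAct i.1 g).hom.branchMap (β' i) = β' i) →
          ιQ g ∈ ((𝒢.branchSubgroup b v hb).map (MulAut.conj x).toMonoidHom).map ψ ⊓
            ((𝒢.branchSubgroup b' v hb').map (MulAut.conj x').toMonoidHom).map ψ)
    (v : 𝒢.graph.Vertex)
    (hpers : ∀ j, ∃ x : (D.tree j).Vertex, (D.proj j).vertexMap x = v ∧
      ∀ g ∈ C, (D.act j g).hom.vertexMap x = x) :
    ∃ x : ∀ j, (D.tree j).Vertex, (∀ ⦃i j : D.J⦄ (h : i ≤ j), (D.trans h).vertexMap (x j) = x i) ∧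
      ∀ g ∈ C, ∀ j, (D.act j g).hom.vertexMap (x j) = x j := by
  refine D.hfix_of_eventually_finite_images C hC fun j => ?_
  obtain ⟨k, h, hcase⟩ := D.pointOrEdge_images_of_persistent level quot levelAct levelTrans levelProj h𝒢 C
    hC1 quot_isImmersion act_quot trans_quot levelTrans_id levelTrans_comp quot_proj levelTrans_proj finV finB
    hlf stabC v hpers j
  refine ⟨k, h, ?_⟩
  rcases hcase with ⟨y, hy⟩ | ⟨e, he⟩
  · refine (Set.finite_singleton y).subset ?_
    rintro _ ⟨x, hx, rfl⟩
    exact hy x hx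
  · -- inside the end-vertices of `e`: finitely many
    have hfinB : {b : (D.tree j).Branch | (D.tree j).edgeOf b = e}.Finite := by
      obtain ⟨b₁, b₂, -, -, -, hall⟩ := (D.tree j).two_branches e
      refine ((Set.finite_singleton b₂).insert b₁).subset fun b hb => ?_
      rcases hall b hb with rfl | rfl
      · exact Set.mem_insert _ _
      · exact Set.mem_insert_of_mem _ rfl
    refine (((hfinB.image fun b => (D.tree j).abuts b).preimage
      (Set.injOn_of_injective (Option.some_injective _))).subset ?_)
    rintro _ ⟨x, hx, rfl⟩
    obtain ⟨b, hbe, hb⟩ := he x hx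
    exact ⟨b, hbe, hb⟩

/-- **`hbdd` over a persistent vertex of a locally finite `𝔾`** (bound `4`): two compatible `C`-fixed
vertex systems are, at every level, equal or the two ends of one edge.
[cite: MochizukiSemiAnbd2006, Thm 3.7(iii) p.41] -/
theorem hbdd_of_persistent_locFin (h𝒢 : 𝒢.Thm37Hypotheses) (C : Subgroup c.G) (hC1 : C ≠ ⊥)
    (quot_isImmersion : ∀ j, SemiGraph.IsImmersion (quot j))
    (act_quot : ∀ (j : D.J) (g : c.G), (D.act j g).hom ≫ quot j = quot j ≫ (levelAct j g).hom)
    (trans_quot : ∀ ⦃i j : D.J⦄ (h : i ≤ j), D.trans h ≫ quot i = quot j ≫ levelTrans h)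
    (levelTrans_id : ∀ j, levelTrans (le_refl j) = 𝟙 (level j))
    (levelTrans_comp : ∀ ⦃i j k : D.J⦄ (hij : i ≤ j) (hjk : j ≤ k),
      levelTrans hjk ≫ levelTrans hij = levelTrans (hij.trans hjk))
    (quot_proj : ∀ j, quot j ≫ levelProj j = D.proj j)
    (levelTrans_proj : ∀ ⦃i j : D.J⦄ (h : i ≤ j), levelTrans h ≫ levelProj i = levelProj j)
    (finV : ∀ (j : D.J) (v : 𝒢.graph.Vertex), {w : (level j).Vertex | (levelProj j).vertexMap w = v}.Finite)
    (finB : ∀ (j : D.J) (b : 𝒢.graph.Branch), {β : (level j).Branch | (levelProj j).branchMap β = b}.Finite)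
    (hlf : ∀ v : 𝒢.graph.Vertex, {b : 𝒢.graph.Branch | 𝒢.graph.abuts b = some v}.Finite)
    (stabC : ∀ (j₀ : D.J) (w : ∀ i : {i : D.J // j₀ ≤ i}, (level i.1).Vertex)
      (β β' : ∀ i : {i : D.J // j₀ ≤ i}, (level i.1).Branch),
      (∀ i, β i ≠ β' i ∧ (level i.1).abuts (β i) = some (w i) ∧ (level i.1).abuts (β' i) = some (w i)) →
      (∀ ⦃i i' : {i : D.J // j₀ ≤ i}⦄ (h : i.1 ≤ i'.1), (levelTrans h).vertexMap (w i') = w i ∧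
        (levelTrans h).branchMap (β i') = β i ∧ (levelTrans h).branchMap (β' i') = β' i) →
      ∃ (Q : Type u) (_ : Group Q) (ιQ : c.G →* Q) (v : 𝒢.graph.Vertex) (b b' : 𝒢.graph.Branch)
        (hb : 𝒢.graph.abuts b = some v) (hb' : 𝒢.graph.abuts b' = some v) (ψ : 𝒢.Gv v →* Q) (x x' : 𝒢.Gv v),
        Set.InjOn ιQ C ∧ Function.Injective ψ ∧ (b' ≠ b ∨ x⁻¹ * x' ∉ 𝒢.branchSubgroup b v hb) ∧
        ∀ g ∈ C, (∀ i, (levelAct i.1 g).hom.vertexMap (w i) = w i ∧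
          (levelAct i.1 g).hom.branchMap (β i) = β i ∧ (levelAct i.1 g).hom.branchMap (β' i) = β' i) →
          ιQ g ∈ ((𝒢.branchSubgroup b v hb).map (MulAut.conj x).toMonoidHom).map ψ ⊓
            ((𝒢.branchSubgroup b' v hb').map (MulAut.conj x').toMonoidHom).map ψ)
    (v : 𝒢.graph.Vertex)
    (hpers : ∀ j, ∃ x : (D.tree j).Vertex, (D.proj j).vertexMap x = v ∧
      ∀ g ∈ C, (D.act j g).hom.vertexMap x = x)
    (x x' : ∀ j, (D.tree j).Vertex)
    (hx : ∀ ⦃i j : D.J⦄ (h : i ≤ j), (D.trans h).vertexMap (x j) = x i)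
    (hx' : ∀ ⦃i j : D.J⦄ (h : i ≤ j), (D.trans h).vertexMap (x' j) = x' i)
    (hfx : ∀ g ∈ C, ∀ j, (D.act j g).hom.vertexMap (x j) = x j)
    (hfx' : ∀ g ∈ C, ∀ j, (D.act j g).hom.vertexMap (x' j) = x' j) :
    ∃ N : ℕ, ∀ j, (D.tree j).subdivision.dist (Sum.inl (x j)) (Sum.inl (x' j)) ≤ N := by
  refine ⟨4, fun j => ?_⟩
  rcases D.pointOrEdge_aux level quot levelAct levelTrans levelProj h𝒢 C hC1 quot_isImmersion act_quot
      trans_quot levelTrans_id levelTrans_comp quot_proj levelTrans_proj finV finB hlf stabC v hpers x x' hx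
      hx' hfx hfx' j with heq | ⟨e, b, b', hbe, hb'e, hb, hb'⟩
  · rw [heq, SimpleGraph.dist_self]; exact Nat.zero_le _
  · exact SemiGraph.subdivision_dist_le_four_of_joined hbe hb'e hb hb'

end Levels

end VerticialLevelData

end ProfiniteSemiGraph

namespace ProfiniteSemiGraph

open CategoryTheory Topology

universe u

variable {𝒢 : ProfiniteSemiGraph.{u}}

/-! ### Finite level fibres of a finite covering over an arbitrary `𝒢` -/

namespace CovObj

variable (S : CovObj 𝒢)

/-- The vertex-orbits of a FINITE covering over a given vertex of `𝒢` are finitely many (orbits of the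
finite fibre `S_v`). [cite: MochizukiSemiAnbd2006, Def 3.5(i) p.37] -/
theorem finite_oVertex_over (hS : S.IsFinite) (v : 𝒢.graph.Vertex) :
    {w : S.orbitGraph.Vertex | S.orbitGraphProj.vertexMap w = v}.Finite := by
  haveI : Finite (S.SV v).obj.V := hS.finite_V v
  refine (Set.finite_range fun y : (S.SV v).obj.V => (Quot.mk _ ⟨v, y⟩ : S.OVertex)).subset ?_
  intro w hw
  induction w using Quot.ind with
  | mk q =>
    obtain ⟨v', y⟩ := q
    have hv : v' = v := hw
    subst hv
    exact ⟨y, rfl⟩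

/-- The branches of the covering semi-graph of a FINITE covering over a given branch of `𝒢` are finitely
many (edge-orbits over its edge). [cite: MochizukiSemiAnbd2006, Def 3.5(i) p.37] -/
theorem finite_orbitGraph_branch_over (hS : S.IsFinite) (b : 𝒢.graph.Branch) :
    {β : S.orbitGraph.Branch | S.orbitGraphProj.branchMap β = b}.Finite := by
  haveI : Finite (S.SE (𝒢.graph.edgeOf b)).obj.V := hS.finite_E _
  refine (Set.finite_range fun y : (S.SE (𝒢.graph.edgeOf b)).obj.V =>
    (⟨(b, Quot.mk _ ⟨𝒢.graph.edgeOf b, y⟩), rfl⟩ : S.orbitGraph.Branch)).subset ?_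
  rintro ⟨⟨b', E⟩, hE⟩ hb
  change b' = b at hb
  subst hb
  induction E using Quot.ind with
  | mk q =>
    obtain ⟨e, y⟩ := q
    change e = 𝒢.graph.edgeOf b' at hE
    subst hE
    exact ⟨y, rfl⟩

end CovObj

/-! ### (FIX∞) at the canonical tower over a persistent vertex of a locally finite `𝔾` -/

/-- **`hfix` at the canonical tower over a persistent vertex, `𝔾` locally finite** ([SemiAnbd] p. 41 "a
compatible system of vertices … fixed by `H`"): for `𝒢` as in Thm. 3.7 with finitely many branches at each
vertex and a compact `C ≠ 1` of the constructed `π₁^temp(𝒢)` fixing at every level a tree vertex over one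
base vertex `v`, `C` fixes a compatible system of tree vertices.
[cite: MochizukiSemiAnbd2006, Thm 3.7(iii) p.41] -/
theorem hfix_temperedPiChart_of_persistent_locFin (h37 : 𝒢.Thm37Hypotheses)
    (hlf : ∀ v : 𝒢.graph.Vertex, {b : 𝒢.graph.Branch | 𝒢.graph.abuts b = some v}.Finite)
    (C : Subgroup (𝒢.temperedPiChart h37.toProp36Hypotheses).G)
    (hC : IsCompact (C : Set (𝒢.temperedPiChart h37.toProp36Hypotheses).G)) (hC1 : C ≠ ⊥)
    (v : 𝒢.graph.Vertex)
    (hpers : ∀ j, ∃ x : ((verticialLevelData_temperedPiChart (h36 := h37.toProp36Hypotheses)).tree j).Vertex,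
      ((verticialLevelData_temperedPiChart (h36 := h37.toProp36Hypotheses)).proj j).vertexMap x = v ∧
      ∀ g ∈ C, ((verticialLevelData_temperedPiChart (h36 := h37.toProp36Hypotheses)).act j g).hom.vertexMap x = x) :
    ∃ x : ∀ j, ((verticialLevelData_temperedPiChart (h36 := h37.toProp36Hypotheses)).tree j).Vertex,
      (∀ ⦃i j : ℕ⦄ (h : i ≤ j),
        ((verticialLevelData_temperedPiChart (h36 := h37.toProp36Hypotheses)).trans h).vertexMap (x j) = x i) ∧
      ∀ g ∈ C, ∀ j,
        ((verticialLevelData_temperedPiChart (h36 := h37.toProp36Hypotheses)).act j g).hom.vertexMap (x j) = x j := by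
  let h36 := h37.toProp36Hypotheses
  let G := 𝒢.galoisLevelData h36
  exact (verticialLevelData_temperedPiChart (h36 := h36)).hfix_of_persistent_locFin
    (fun n => (G.S n).orbitGraph) (fun n => G.treeQuot n)
    (fun n => (G.levelAct h36.isCountable (𝒢.galoisLevelData_hconn h36) n).comp (MonoidHom.id _))
    (fun _ _ h => G.levelTrans h) (fun n => (G.S n).orbitGraphProj) h37 C hC hC1
    (fun n => G.treeQuot_isImmersion n)
    (fun n g => G.treeQuot_act h36.isCountable (𝒢.galoisLevelData_hconn h36) n g)
    (fun _ _ h => G.treeTrans_quot h) (fun n => G.levelTrans_self n) (fun _ _ _ hij hjk => G.levelTrans_comp hij hjk)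
    (fun n => rfl) (fun _ _ h => G.levelTrans_proj h)
    (fun n w => (G.S n).finite_oVertex_over (𝒢.galoisLevelData_isFinite h36 n) w)
    (fun n b => (G.S n).finite_orbitGraph_branch_over (𝒢.galoisLevelData_isFinite h36 n) b) hlf
    (fun j₀ w β β' hpair hcompat =>
      𝒢.stabBranchPairCpt'_temperedPiChart h36 (galoisLevelData_faithfulV 𝒢 h37) C hC j₀ w β β' hpair hcompat)
    v hpers

/-- **`hbdd` at the canonical tower over a persistent vertex, `𝔾` locally finite** (bound `4`): two
compatible `C`-fixed vertex systems stay at subdivision distance `≤ 4` — the binder `hbdd` of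
`compactInVerticialAt_of_noEscape` for such `C`. [cite: MochizukiSemiAnbd2006, Thm 3.7(iii) p.41] -/
theorem hbdd_temperedPiChart_of_persistent_locFin (h37 : 𝒢.Thm37Hypotheses)
    (hlf : ∀ v : 𝒢.graph.Vertex, {b : 𝒢.graph.Branch | 𝒢.graph.abuts b = some v}.Finite)
    (C : Subgroup (𝒢.temperedPiChart h37.toProp36Hypotheses).G)
    (hC : IsCompact (C : Set (𝒢.temperedPiChart h37.toProp36Hypotheses).G)) (hC1 : C ≠ ⊥)
    (v : 𝒢.graph.Vertex)
    (hpers : ∀ j, ∃ x : ((verticialLevelData_temperedPiChart (h36 := h37.toProp36Hypotheses)).tree j).Vertex,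
      ((verticialLevelData_temperedPiChart (h36 := h37.toProp36Hypotheses)).proj j).vertexMap x = v ∧
      ∀ g ∈ C, ((verticialLevelData_temperedPiChart (h36 := h37.toProp36Hypotheses)).act j g).hom.vertexMap x = x)
    (x x' : ∀ j, ((verticialLevelData_temperedPiChart (h36 := h37.toProp36Hypotheses)).tree j).Vertex)
    (hx : ∀ ⦃i j : ℕ⦄ (h : i ≤ j),
      ((verticialLevelData_temperedPiChart (h36 := h37.toProp36Hypotheses)).trans h).vertexMap (x j) = x i)
    (hx' : ∀ ⦃i j : ℕ⦄ (h : i ≤ j),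
      ((verticialLevelData_temperedPiChart (h36 := h37.toProp36Hypotheses)).trans h).vertexMap (x' j) = x' i)
    (hfx : ∀ g ∈ C, ∀ j,
      ((verticialLevelData_temperedPiChart (h36 := h37.toProp36Hypotheses)).act j g).hom.vertexMap (x j) = x j)
    (hfx' : ∀ g ∈ C, ∀ j,
      ((verticialLevelData_temperedPiChart (h36 := h37.toProp36Hypotheses)).act j g).hom.vertexMap (x' j) = x' j) :
    ∃ N : ℕ, ∀ j, ((verticialLevelData_temperedPiChart (h36 := h37.toProp36Hypotheses)).tree j).subdivision.dist
      (Sum.inl (x j)) (Sum.inl (x' j)) ≤ N := by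
  let h36 := h37.toProp36Hypotheses
  let G := 𝒢.galoisLevelData h36
  exact (verticialLevelData_temperedPiChart (h36 := h36)).hbdd_of_persistent_locFin
    (fun n => (G.S n).orbitGraph) (fun n => G.treeQuot n)
    (fun n => (G.levelAct h36.isCountable (𝒢.galoisLevelData_hconn h36) n).comp (MonoidHom.id _))
    (fun _ _ h => G.levelTrans h) (fun n => (G.S n).orbitGraphProj) h37 C hC1
    (fun n => G.treeQuot_isImmersion n)
    (fun n g => G.treeQuot_act h36.isCountable (𝒢.galoisLevelData_hconn h36) n g)
    (fun _ _ h => G.treeTrans_quot h) (fun n => G.levelTrans_self n) (fun _ _ _ hij hjk => G.levelTrans_comp hij hjk)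
    (fun n => rfl) (fun _ _ h => G.levelTrans_proj h)
    (fun n w => (G.S n).finite_oVertex_over (𝒢.galoisLevelData_isFinite h36 n) w)
    (fun n b => (G.S n).finite_orbitGraph_branch_over (𝒢.galoisLevelData_isFinite h36 n) b) hlf
    (fun j₀ w β β' hpair hcompat =>
      𝒢.stabBranchPairCpt'_temperedPiChart h36 (galoisLevelData_faithfulV 𝒢 h37) C hC j₀ w β β' hpair hcompat)
    v hpers x x' hx hx' hfx hfx'

/-! ### Theorem 3.7 (iii) AT a locally finite `𝒢` from «no horizontal escape» -/

/-- **[SemiAnbd] Theorem 3.7 (iii) AT a locally finite countable `𝒢`, modulo only «every nontrivial compact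
subgroup has a persistent base vertex»** (pp. 40–41): if `𝒢` satisfies the hypotheses of Thm. 3.7, has
finitely many branches at every vertex, and every nontrivial compact subgroup of the constructed
`π₁^temp(𝒢)` fixes, at every level of the canonical tower, some tree vertex over ONE base vertex (no
horizontal escape), then `CompactInVerticialAt 𝒢`: every compact subgroup of every `π₁^temp(𝒢)` lies in a
verticial subgroup, in at most two, and then in an edge-like subgroup of a closed edge.  The persistence
input holds at finite `𝔾` and fails at the countermodel `𝒢_θ`; it is asserted here for no `𝒢`.
[cite: MochizukiSemiAnbd2006, Thm 3.7(iii) pp.40-41] -/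
theorem compactInVerticialAt_of_locallyFinite_of_persistent (h37 : 𝒢.Thm37Hypotheses)
    (hlf : ∀ v : 𝒢.graph.Vertex, {b : 𝒢.graph.Branch | 𝒢.graph.abuts b = some v}.Finite)
    (hpers : ∀ (C : Subgroup (𝒢.temperedPiChart h37.toProp36Hypotheses).G),
      IsCompact (C : Set (𝒢.temperedPiChart h37.toProp36Hypotheses).G) → C ≠ ⊥ →
      ∃ v : 𝒢.graph.Vertex, ∀ j,
        ∃ x : ((verticialLevelData_temperedPiChart (h36 := h37.toProp36Hypotheses)).tree j).Vertex,
          ((verticialLevelData_temperedPiChart (h36 := h37.toProp36Hypotheses)).proj j).vertexMap x = v ∧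
          ∀ g ∈ C, ((verticialLevelData_temperedPiChart (h36 := h37.toProp36Hypotheses)).act j g).hom.vertexMap x = x) :
    CompactInVerticialAt 𝒢 := by
  refine compactInVerticialAt_of_noEscape h37 (fun C hC hC1 => ?_) (fun C hC hC1 x x' hx hx' hfx hfx' => ?_)
  · obtain ⟨v, hv⟩ := hpers C hC hC1
    obtain ⟨x, hx, hfx⟩ := hfix_temperedPiChart_of_persistent_locFin h37 hlf C hC hC1 v hv
    exact (verticialLevelData_temperedPiChart (h36 := h37.toProp36Hypotheses)).hdisp_of_hfix C x hx hfx
  · obtain ⟨v, hv⟩ := hpers C hC hC1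
    exact hbdd_temperedPiChart_of_persistent_locFin h37 hlf C hC hC1 v hv x x' hx hx' hfx hfx'

/-- **Dichotomy at a locally finite countable `𝒢`: Theorem 3.7 (iii) holds AT `𝒢`, or some nontrivial
compact subgroup ESCAPES HORIZONTALLY** along the canonical tower (its base images `B j` — the vertices of
`𝔾` under `C`-fixed tree vertices of `𝒢_{∞,j}` — have empty intersection; by abc-iut-w4-d080's
`baseFixedImage_nonempty/antitone/joined` and abc-iut-w5-d189's GEN-ENDS such an escape runs along a ray of
`𝔾`, as at the countermodel `𝒢_θ`).  [cite: MochizukiSemiAnbd2006, Thm 3.7(iii) pp.40-41] -/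
theorem compactInVerticialAt_or_horizontalEscape (h37 : 𝒢.Thm37Hypotheses)
    (hlf : ∀ v : 𝒢.graph.Vertex, {b : 𝒢.graph.Branch | 𝒢.graph.abuts b = some v}.Finite) :
    CompactInVerticialAt 𝒢 ∨
      ∃ C : Subgroup (𝒢.temperedPiChart h37.toProp36Hypotheses).G,
        IsCompact (C : Set (𝒢.temperedPiChart h37.toProp36Hypotheses).G) ∧ C ≠ ⊥ ∧
        ∀ v : 𝒢.graph.Vertex, ∃ j : ℕ,
          v ∉ ((verticialLevelData_temperedPiChart (h36 := h37.toProp36Hypotheses)).proj j).vertexMap ''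
            {x | ∀ g ∈ C, ((verticialLevelData_temperedPiChart (h36 := h37.toProp36Hypotheses)).act j g).hom.vertexMap x = x} := by
  by_cases h : ∀ (C : Subgroup (𝒢.temperedPiChart h37.toProp36Hypotheses).G),
      IsCompact (C : Set (𝒢.temperedPiChart h37.toProp36Hypotheses).G) → C ≠ ⊥ →
      ∃ v : 𝒢.graph.Vertex, ∀ j,
        ∃ x : ((verticialLevelData_temperedPiChart (h36 := h37.toProp36Hypotheses)).tree j).Vertex,
          ((verticialLevelData_temperedPiChart (h36 := h37.toProp36Hypotheses)).proj j).vertexMap x = v ∧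
          ∀ g ∈ C, ((verticialLevelData_temperedPiChart (h36 := h37.toProp36Hypotheses)).act j g).hom.vertexMap x = x
  · exact Or.inl (compactInVerticialAt_of_locallyFinite_of_persistent h37 hlf h)
  · right
    push Not at h
    obtain ⟨C, hC, hC1, hno⟩ := h
    refine ⟨C, hC, hC1, fun v => ?_⟩
    obtain ⟨j, hj⟩ := hno v
    refine ⟨j, ?_⟩
    rintro ⟨x, hx, hxv⟩
    obtain ⟨g, hg, hgx⟩ := hj x hxv
    exact hgx (hx g hg)

end ProfiniteSemiGraph

end Literature.AnabelianGeometry.SemiGraphs
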